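import Summits.Schanuel.Schanuel.Theorems.RootDecomp1KXLinear04

/-!
# RootDecomp1KXLinear — lens 1, generation 45, node 2 (g45b) «X-LINEAR THIN FIBRE: ALL CURVES A(Y) + x·B(Y) WITH deg B < deg A, HYPOTHESIS-FREE» (RULE K-R31 (ii) second clause + K-R32 (i); CLAIM L2261, ACK/CHECKLIST K-g45b L2262, NODE L2274 / REQUEST L2275, critic VERDICT L2278: CLEARED — THEOREM ×2; port shape L2282 (d)) — continuation (RootDecomp1KXLinear05): §X part 4 — pole gap e = 1, the headlines, typed classes, consumer

(lens-1 g45b HOME kernel K₂ = HOME/decomp-schanuel-lens-1/g45b/DLxlinear.lean db54a0a5…, 3838 l = the DegreeLadder ed. 3 prefix (tree: RootDecomp1KDegreeLadder01–09) + `XLinearCore` (l.2184–2562) + §X (l.2564–3836); imports SkelCell01 + Literature RidoutIntegers (BUILT on the farm since 20:13Z). Port by census-1 gen 19 as `RootDecomp1KXLinear01`–`05`: 01 = XLinearCore (namespace `…RootDecomp1KXLinearCore`; the 2-adic CORE LEMMA `core` — second-order approximation of the nearest e-th root by the rationally shifted point — `roots_structure`, and Step 5 `ridout_step` with `Ridout.padicRoth_int`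 BY TREE NAME; imports tree DegreeLadder08 + Literature RidoutIntegers); 02–05 = §X (namespace `…RootDecomp1KXLinear`): 02 = `xLinP`, `gap`, level points `OnLevel`, Steps 1a/1b/2/6, 2-adic infrastructure (first half); 03 = 2-adic infrastructure (second half: the shifted integer, valuation bookkeeping); 04 = the composition `levels_finite` → `thinFibreAt_xLinP` (scoped `maxHeartbeats 800000` ×2 as in K) + common rational roots; 05 = pole gap e = 1 `thinFibreAt_xLinP_gapOne` (no Ridout), `thinFibreAt_xLinear`, `thinFibreAt_xLinear_of_lt`, the typed classes `XLinearGap2` / `XLinearLt` with `thinFibreAt_of_xLinearGap2` / `thinFibreAt_of_xLinearLt` / `thinFibreAt_sqMulP'` (all c ≠ 0), positions and non-members (`not_xLinearGap2_lineP`, `cuspP`), the consumer `xLinear_nonvanishing (hm : 2 ≤ m) (hρ : SkelLiouvilleFix m ρ) (A B) (hB : B ≠ 0) (hlt : B.natDegree < A.natDegree) : aeval ρ A + liouvilleNumber 2 * aeval ρ B ≠ 0` — ALL HYPOTHESIS-FREE.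
PORT EDITS (critic L2282 (d)): the DegreeLadder prefix dropped (tree parts imported); the `(hR : PadicRothInt)` binder REMOVED from the ten decls that carried it and `Literature.NumberTheory.DiophantineApproximation.Ridout.padicRoth_int` fed directly at the one use site in `ridout_step`; the §HypFree primed twins and `padicRothInt_holds` DROPPED (the unprimed names now denote the binder-free forms); `open …DegreeLadder (PadicRothInt pTwo)` ↦ `(pTwo)`; two linter options dropped; 22 one-line docstrings added; seven generic p-adic/arithmetic helpers private (`norm_natCast_le_one`, `norm_two`, `norm_two_pow`, `norm_intCast_le_one'`, `factorial_sub_ge`, `natDegree_linear`, `den_dvd_leadingCoeff` — dedup-safety vs DegreeLadder08's private 2-adic lemmas) with per-part private copies, plus private copies of the DegreeLadder port's private ℓ₂/psNumer lemmas where §X uses them; statements and proofs otherwise verbatim. `--supports stmt-Schanuel-33364`; no census credit carried; rung 0 — nothing here proves Schanuel; `ThinFibre m₀` (all curves) stays OPEN / IDEA-NEEDED.)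
-/

noncomputable section

namespace Summit.Schanuel.Schanuel.Theorems.RootDecomp1KXLinear

open Polynomial LiouvilleNumber
open scoped Nat
open Summit.Schanuel.Schanuel.Theorems.RootDecomp1KSkelCell
  (exists_le_two_pow_factorial iota iota_spec iota_le_of_le pow_lt_of_lt_iota lt_iota_of_pow_lt iota_mono
   one_le_iota SkelLiouville SkelLiouvilleFix skelLiouville_iff_fix SkelLiouvilleFix.mono uStar dU rU dU_cast
   two_pow_le_four_mul_dU two_mul_dU_lt one_le_dU rU_den rU_cast uStar_sub_rU skelLiouvilleFix_one_uStar
   not_skelFixOne_algebraicIndependent)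
open Summit.Schanuel.Schanuel.Theorems.RootDecomp1KTwoBaseCell (psNumer partialSum_eq_psNumer_div coprime_psNumer
  algebraicIndependent_of_forall_int')
open Summit.Schanuel.Schanuel.Theorems.RootDecomp1KRelLiouvilleCell (partialSum_two_strictMono
  partialSum_two_lt_liouvilleNumber abs_liouvilleNumber_two_sub_partialSum)
open Summit.Schanuel.Schanuel.Theorems.RootDecomp1KDegreeLadder
open Summit.Schanuel.Schanuel.Theorems.RootDecomp1KXLinearCore (core ridout_step)

/-! ### Removing the coprimality hypothesis: common rational roots are horizontal lines -/

/-- A left factor whose value does not depend on `x` (a union of horizontal lines) can be removed. -/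
theorem thinFibreAt_mul_left {m₀ : ℕ} (Q P : ℤ[X][X]) (hQ : ∀ x x' y, bev Q x y = bev Q x' y)
    (hP : ThinFibreAt m₀ P) : ThinFibreAt m₀ (Q * P) := by
  intro C
  obtain ⟨N₀, hN₀⟩ := hP C
  refine ⟨N₀, fun N hN r hr hzero hnd => ?_⟩
  rw [bev_mul] at hzero
  obtain ⟨x, hx⟩ := hnd
  rw [bev_mul] at hx
  have hQ0 : bev Q (partialSum 2 N) r ≠ 0 := by rw [hQ _ x]; exact left_ne_zero_of_mul hx
  have hP0 : bev P (partialSum 2 N) r = 0 := (mul_eq_zero.mp hzero).resolve_left hQ0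
  exact hN₀ N hN r hr hP0 ⟨x, right_ne_zero_of_mul hx⟩

/-- A rational root `n/d` of `A ∈ ℤ[Y]` gives the primitive factor `dY − n` over `ℤ` (Gauss's lemma). -/
theorem exists_linear_factor (A : ℤ[X]) (r₀ : ℚ) (hA : aeval r₀ A = 0) :
    ∃ A₁ : ℤ[X], A = (C (r₀.den : ℤ) * X - C r₀.num) * A₁ := by
  set p : ℤ[X] := C (r₀.den : ℤ) * X - C r₀.num with hp
  have hprim : p.IsPrimitive := by
    rw [isPrimitive_iff_isUnit_of_C_dvd]
    intro c hc
    have h1 : c ∣ p.coeff 1 := (C_dvd_iff_dvd_coeff c p).mp hc 1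
    have h0 : c ∣ p.coeff 0 := (C_dvd_iff_dvd_coeff c p).mp hc 0
    simp only [hp, coeff_sub, coeff_C_mul, coeff_X_one, mul_one, coeff_C_zero, coeff_X_zero, mul_zero,
      zero_sub, dvd_neg, coeff_C_succ, sub_zero] at h1 h0
    have hg : c ∣ (Int.gcd r₀.num (r₀.den : ℤ) : ℤ) := Int.dvd_coe_gcd h0 h1
    have hred : Int.gcd r₀.num (r₀.den : ℤ) = 1 := by
      rw [Int.gcd_eq_natAbs, Int.natAbs_natCast]; exact r₀.reduced
    rw [hred] at hg
    exact isUnit_of_dvd_one (by exact_mod_cast hg)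
  have hdvd : p ∣ A := by
    rw [IsPrimitive.Int.dvd_iff_map_cast_dvd_map_cast p A hprim]
    have hden : (r₀.den : ℚ) ≠ 0 := by exact_mod_cast r₀.den_nz
    have hmap : p.map (Int.castRingHom ℚ) = C (r₀.den : ℚ) * (X - C r₀) := by
      rw [hp, Polynomial.map_sub, Polynomial.map_mul, map_C, map_X, map_C]
      simp only [eq_intCast, Int.cast_natCast]
      rw [show ((r₀.num : ℤ) : ℚ) = (r₀.den : ℚ) * r₀ by rw [mul_comm]; exact (Rat.mul_den_eq_num r₀).symm,
        mul_sub, ← C_mul]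
    rw [hmap, IsUnit.mul_left_dvd (isUnit_C.mpr (isUnit_iff_ne_zero.mpr hden)), dvd_iff_isRoot, IsRoot.def,
      eval_map, ← algebraMap_int_eq, ← aeval_def]
    exact hA
  exact hdvd

/-- The integer linear polynomial `den·X − num` has degree `1`. -/
private theorem natDegree_linear (r₀ : ℚ) : (C (r₀.den : ℤ) * X - C r₀.num).natDegree = 1 := by
  have hden : (r₀.den : ℤ) ≠ 0 := by exact_mod_cast r₀.den_nz
  rw [sub_eq_add_neg, ← C_neg, natDegree_add_C, natDegree_C_mul_X _ hden]

/-! ### Pole gap `e = 1`: the size argument alone (no Ridout input), for `m₀ ≥ 2` -/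

/-- the elementary inequality behind the gap-one case: for `N ≥ 2|κ| + 2` and `t = N! + κ`,
`(N+1)! + N ≤ 2·N·t`. -/
theorem gap_one_ineq {N t : ℕ} {κ : ℤ} (ht : (t : ℤ) = (N ! : ℕ) + κ) (hN : 2 * κ.natAbs + 2 ≤ N) :
    (N + 1)! + N ≤ 2 * N * t := by
  obtain ⟨M, rfl⟩ : ∃ M, N = M + 1 := ⟨N - 1, by omega⟩
  have hM : (2 * κ.natAbs + 1 : ℤ) ≤ M := by omega
  have hMf : (1 : ℤ) ≤ (M ! : ℕ) := by exact_mod_cast Nat.one_le_iff_ne_zero.mpr (Nat.factorial_ne_zero M)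
  have habs : (κ.natAbs : ℤ) = |κ| := Int.natCast_natAbs κ
  have h1 : -|κ| ≤ κ := neg_abs_le κ
  have h2 : (0 : ℤ) ≤ |κ| := abs_nonneg κ
  have key : ((M + 1 + 1)! + (M + 1) : ℤ) ≤ 2 * (M + 1) * t := by
    have e1 : ((M + 1 + 1)! : ℤ) = (M + 2) * ((M + 1) * (M ! : ℕ)) := by
      rw [Nat.factorial_succ, Nat.factorial_succ]; push_cast; ring
    have e2 : ((M + 1)! : ℕ) = (M + 1) * M ! := Nat.factorial_succ M
    rw [e2] at ht
    push_cast at ht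
    rw [e1, ht]
    have hMM : (2 * |κ| + 1 : ℤ) * 1 ≤ (M : ℤ) * (M ! : ℕ) := by
      apply mul_le_mul (by rw [habs] at hM; exact hM) hMf zero_le_one (by positivity)
    nlinarith
  exact_mod_cast key

/-- POLE GAP `e = 1` (no Ridout input; pure size argument): `ThinFibreAt m₀ (xLinP A B)` for `deg A = deg B + 1`, `m₀ ≥ 2`, assuming no common rational root. -/
theorem thinFibreAt_xLinP_gapOne (A B : ℤ[X]) (hAB1 : A.natDegree = B.natDegree + 1)
    (hAB : ∀ r : ℚ, aeval r A = 0 → aeval r B = 0 → False) {m₀ : ℕ} (hm : 2 ≤ m₀) :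
    ThinFibreAt m₀ (xLinP A B) := by
  intro C
  classical
  have hdeg : B.natDegree < A.natDegree := by omega
  have hA0 : A ≠ 0 := by rintro rfl; simp at hdeg
  have ha : A.leadingCoeff ≠ 0 := leadingCoeff_ne_zero.mpr hA0
  have hgap : gap A B = 1 := by unfold gap; omega
  -- the finitely many levels carrying a small-`t` point with `|r| ≤ C`
  set F : Set ℚ := {r : ℚ | |(r : ℝ)| ≤ C ∧ (r.den : ℤ) ∣ A.leadingCoeff * 2 ^ padicValNat 2 r.den ∧
    padicValNat 2 r.den ≤ tee0 A B} with hF_def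
  have hF : F.Finite := small_points_finite _ ha C (tee0 A B)
  have hL : (⋃ r ∈ F, {N : ℕ | OnLevel A B N r}).Finite :=
    hF.biUnion fun r _ => levels_of_point_finite hAB r
  obtain ⟨N₁, hN₁⟩ := hL.bddAbove
  obtain ⟨N₃, hN₃⟩ := exists_nat_gt C
  refine ⟨max (N₁ + 1) (max (2 * (kap A B).natAbs + 2) N₃), fun N hN r hr hP _ => ?_⟩
  have hN1 : N₁ < N := by omega
  have hN2 : 2 * (kap A B).natAbs + 2 ≤ N := by omega
  have hN3 : N₃ ≤ N := by omega
  have hpt : OnLevel A B N r := onLevel_of_bev hP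
  have hAr := onLevel_A_ne_zero hAB hpt
  have hBr := onLevel_B_ne_zero hAB hpt
  set t : ℕ := padicValNat 2 r.den with ht_def
  -- `t > T₀`, else the point is small and its level is `≤ N₁`
  have ht0 : tee0 A B < t := by
    by_contra hle
    push Not at hle
    have hrF : r ∈ F := ⟨hr, den_dvd_lc_two_pow A B hdeg hpt, hle⟩
    have : N ∈ ⋃ r ∈ F, {N : ℕ | OnLevel A B N r} := Set.mem_biUnion hrF hpt
    exact absurd (hN₁ this) (by omega)
  have hval := val_relation A B hdeg (by omega) hpt hAr hBr ht0
  rw [hgap, one_mul] at hval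
  have hineq : (N + 1)! + N ≤ 2 * N * t := gap_one_ineq hval hN2
  -- `den r ≥ 2^t`
  have hden : (2 : ℝ) ^ t ≤ (r.den : ℝ) := by
    have h1 : 2 ^ t ∣ r.den := pow_padicValNat_dvd
    exact_mod_cast Nat.le_of_dvd r.den_pos h1
  have hC : C < (2 : ℝ) ^ N := by
    calc C < (N₃ : ℝ) := hN₃
      _ ≤ (N : ℝ) := by exact_mod_cast hN3
      _ ≤ (2 : ℝ) ^ N := by exact_mod_cast Nat.lt_two_pow_self.le
  calc C * 2 ^ (N + 1)! < (2 : ℝ) ^ N * 2 ^ (N + 1)! := by gcongr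
    _ = (2 : ℝ) ^ ((N + 1)! + N) := by rw [pow_add, mul_comm]
    _ ≤ (2 : ℝ) ^ (2 * N * t) := pow_le_pow_right₀ (by norm_num) hineq
    _ ≤ (2 : ℝ) ^ (m₀ * N * t) := pow_le_pow_right₀ (by norm_num) (by gcongr)
    _ = ((2 : ℝ) ^ t) ^ (m₀ * N) := by rw [← pow_mul, mul_comm]
    _ ≤ (r.den : ℝ) ^ (m₀ * N) := by gcongr

/-- **Reduction to the coprime case** (common rational roots are horizontal lines `dY = n`, split off by
Gauss's lemma; induction on `deg A`).  `good` is any degree condition stable under `(a+1, b+1) ↦ (a, b)`. -/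
theorem thinFibreAt_xLinP_reduce {m₀ : ℕ} (good : ℕ → ℕ → Prop)
    (hgood : ∀ a b, good (a + 1) (b + 1) → good a b) (hlt : ∀ a b, good a b → b < a)
    (base : ∀ A B : ℤ[X], B ≠ 0 → good A.natDegree B.natDegree →
      (∀ r : ℚ, aeval r A = 0 → aeval r B = 0 → False) → ThinFibreAt m₀ (xLinP A B))
    (A B : ℤ[X]) (hB : B ≠ 0) (hg : good A.natDegree B.natDegree) : ThinFibreAt m₀ (xLinP A B) := by
  suffices h : ∀ (n : ℕ) (A B : ℤ[X]), A.natDegree = n → B ≠ 0 → good A.natDegree B.natDegree →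
      ThinFibreAt m₀ (xLinP A B) from h _ A B rfl hB hg
  intro n
  induction n using Nat.strong_induction_on with
  | _ n ih =>
    intro A B hn hB hg
    by_cases hAB : ∀ r : ℚ, aeval r A = 0 → aeval r B = 0 → False
    · exact base A B hB hg hAB
    push Not at hAB
    obtain ⟨r₀, hA0, hB0, -⟩ := hAB
    obtain ⟨A₁, hA₁⟩ := exists_linear_factor A r₀ hA0
    obtain ⟨B₁, hB₁⟩ := exists_linear_factor B r₀ hB0
    set p : ℤ[X] := C (r₀.den : ℤ) * X - C r₀.num with hp
    have hp1 : p.natDegree = 1 := natDegree_linear r₀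
    have hp0 : p ≠ 0 := by rintro h; rw [h] at hp1; simp at hp1
    have hA0' : A ≠ 0 := by rintro rfl; have := hlt _ _ hg; simp at this
    have hA₁0 : A₁ ≠ 0 := by rintro rfl; rw [mul_zero] at hA₁; exact hA0' hA₁
    have hB₁0 : B₁ ≠ 0 := by rintro rfl; rw [mul_zero] at hB₁; exact hB hB₁
    have hdA : A.natDegree = A₁.natDegree + 1 := by rw [hA₁, natDegree_mul hp0 hA₁0, hp1, add_comm]
    have hdB : B.natDegree = B₁.natDegree + 1 := by rw [hB₁, natDegree_mul hp0 hB₁0, hp1, add_comm]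
    rw [hdA, hdB] at hg
    have ih₁ := ih A₁.natDegree (by omega) A₁ B₁ rfl hB₁0 (hgood _ _ hg)
    have hfac : xLinP A B = Polynomial.map C p * xLinP A₁ B₁ := by
      rw [hA₁, hB₁]; simp only [xLinP, Polynomial.map_mul]; ring
    rw [hfac]
    exact thinFibreAt_mul_left _ _ (fun x x' y => by rw [bev_map_C, bev_map_C]) ih₁

/-- **THE x-LINEAR THIN FIBRE, pole gap `≥ 2`** (Ridout input by tree name, `Ridout.padicRoth_int`): every `m₀`; HYPOTHESIS-FREE. -/
theorem thinFibreAt_xLinear (A B : ℤ[X]) (hB : B ≠ 0) (he : B.natDegree + 2 ≤ A.natDegree)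
    (m₀ : ℕ) : ThinFibreAt m₀ (xLinP A B) :=
  thinFibreAt_xLinP_reduce (fun a b => b + 2 ≤ a) (fun _ _ h => by omega) (fun _ _ h => by omega)
    (fun A B hB he hAB => thinFibreAt_xLinP A B hB he hAB m₀) A B hB he

/-- **THE x-LINEAR THIN FIBRE, pole gap `= 1`** — HYPOTHESIS-FREE (no Ridout): every `m₀ ≥ 2`. -/
theorem thinFibreAt_xLinear_gapOne (A B : ℤ[X]) (hB : B ≠ 0) (h1 : A.natDegree = B.natDegree + 1)
    {m₀ : ℕ} (hm : 2 ≤ m₀) : ThinFibreAt m₀ (xLinP A B) :=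
  thinFibreAt_xLinP_reduce (fun a b => a = b + 1) (fun _ _ h => by omega) (fun _ _ h => by omega)
    (fun A B _ he hAB => thinFibreAt_xLinP_gapOne A B he hAB hm) A B hB h1

/-- **ALL x-linear curves with `deg B < deg A`, at every `m₀ ≥ 2`** (the g46 target of record, case I). -/
theorem thinFibreAt_xLinear_of_lt (A B : ℤ[X]) (hB : B ≠ 0)
    (hlt : B.natDegree < A.natDegree) {m₀ : ℕ} (hm : 2 ≤ m₀) : ThinFibreAt m₀ (xLinP A B) := by
  by_cases he : B.natDegree + 2 ≤ A.natDegree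
  · exact thinFibreAt_xLinear A B hB he m₀
  · exact thinFibreAt_xLinear_gapOne A B hB (by omega) hm

/-! ### The typed class of node 2 and its position in the thin-fibre residual -/

/-- [class] definition (typed curve class with parameters, NOT a fact; census convention, VERDICT L2278): **the typed curve class** `P = A(Y) + x·B(Y)` with `B ≠ 0` and pole-order gap `deg A − deg B ≥ 2`
(all curves `x = −A(Y)/B(Y)`, i.e. `x` a rational function of `Y` whose pole at `Y = ∞` has order `≥ 2`). -/
def XLinearGap2 (P : ℤ[X][X]) : Prop :=
  ∃ A B : ℤ[X], B ≠ 0 ∧ B.natDegree + 2 ≤ A.natDegree ∧ P = xLinP A B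

/-- The thin-fibre clause holds on the whole class `XLinearGap2`, at EVERY `m₀` (Ridout input). -/
theorem thinFibreAt_of_xLinearGap2 {P : ℤ[X][X]} (hP : XLinearGap2 P) (m₀ : ℕ) :
    ThinFibreAt m₀ P := by
  obtain ⟨A, B, hB, he, rfl⟩ := hP
  exact thinFibreAt_xLinear A B hB he m₀

/-- The `y² = c·x` family (node 1, `thinFibreAt_sqMulP`, there only for ODD `c`) is the bottom of the class:
`sqMulP c = xLinP (Y²) (−c)` for every `c ≠ 0`. -/
theorem xLinearGap2_sqMulP (c : ℕ) (hc : c ≠ 0) : XLinearGap2 (sqMulP c) := by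
  refine ⟨X ^ 2, -C (c : ℤ), ?_, ?_, ?_⟩
  · simpa using hc
  · rw [natDegree_neg, natDegree_C, natDegree_X_pow]
  · simp only [sqMulP, xLinP, Polynomial.map_pow, map_X, Polynomial.map_neg, map_C]
    rw [map_mul C]
    ring

/-- in particular node 1's `thinFibreAt_sqMulP` extends from odd `c` to every `c ≠ 0` -/
theorem thinFibreAt_sqMulP' {c : ℕ} (hc : c ≠ 0) (m₀ : ℕ) : ThinFibreAt m₀ (sqMulP c) :=
  thinFibreAt_of_xLinearGap2 (xLinearGap2_sqMulP c hc) m₀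

/-- Members of every `Y`-degree `d ≥ 2` (so the class is not inside `Y`-degree `< m₀` for any `m₀`):
the curves `Y^d − Y = c·x`, `c ≠ 0`. -/
theorem xLinearGap2_pow_sub (d : ℕ) (hd : 2 ≤ d) (c : ℤ) (hc : c ≠ 0) :
    XLinearGap2 (Polynomial.map C (X ^ d - X) + C X * Polynomial.map C (-C c)) := by
  refine ⟨X ^ d - X, -C c, by simpa using hc, ?_, rfl⟩
  have hlt : (X : ℤ[X]).natDegree < (X ^ d : ℤ[X]).natDegree := by
    rw [natDegree_X, natDegree_X_pow]; omega
  rw [natDegree_neg, natDegree_C, natDegree_sub_eq_left_of_natDegree_lt hlt, natDegree_X_pow]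
  omega

/-- The pure members `Y^d − Y = c·x` have `Y`-degree `d`. -/
theorem natDegree_Y_of_xLinearGap2_pow_sub (d : ℕ) (hd : 2 ≤ d) (c : ℤ) :
    (Polynomial.map C (X ^ d - X) + C X * Polynomial.map C (-C c) : ℤ[X][X]).natDegree = d := by
  have hlt : (X : ℤ[X][X]).natDegree < (X ^ d : ℤ[X][X]).natDegree := by
    rw [natDegree_X, natDegree_X_pow]; omega
  have h1 : (Polynomial.map C (X ^ d - X : ℤ[X]) : ℤ[X][X]).natDegree = d := by
    rw [Polynomial.map_sub, Polynomial.map_pow, map_X, natDegree_sub_eq_left_of_natDegree_lt hlt,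
      natDegree_X_pow]
  have h2 : (C X * Polynomial.map C (-C c) : ℤ[X][X]).natDegree = 0 := by
    rw [Polynomial.map_neg, map_C, ← C_neg, ← C_mul, natDegree_C]
  have hlt' : (C X * Polynomial.map C (-C c) : ℤ[X][X]).natDegree <
      (Polynomial.map C (X ^ d - X : ℤ[X]) : ℤ[X][X]).natDegree := by rw [h1, h2]; omega
  rw [natDegree_add_eq_left_of_natDegree_lt hlt', h1]

/-- [class] definition (census convention, VERDICT L2278): **the wider typed class** `P = A(Y) + x·B(Y)`, `B ≠ 0`, `deg B < deg A` — `ThinFibreAt m₀ P` PROVED for every member at `m₀ ≥ 2` (`thinFibreAt_of_xLinearLt`). -/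
def XLinearLt (P : ℤ[X][X]) : Prop :=
  ∃ A B : ℤ[X], B ≠ 0 ∧ B.natDegree < A.natDegree ∧ P = xLinP A B

/-- `XLinearGap2 ⊆ XLinearLt`. -/
theorem xLinearLt_of_xLinearGap2 {P : ℤ[X][X]} (hP : XLinearGap2 P) : XLinearLt P := by
  obtain ⟨A, B, hB, he, rfl⟩ := hP
  exact ⟨A, B, hB, by omega, rfl⟩

/-- The thin-fibre clause holds on `XLinearLt` at every `m₀ ≥ 2` (Ridout input only through the gap-`≥ 2` part;
the gap-one part `thinFibreAt_xLinear_gapOne` is hypothesis-free). -/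
theorem thinFibreAt_of_xLinearLt {P : ℤ[X][X]} (hP : XLinearLt P) {m₀ : ℕ} (hm : 2 ≤ m₀) :
    ThinFibreAt m₀ P := by
  obtain ⟨A, B, hB, hlt, rfl⟩ := hP
  exact thinFibreAt_xLinear_of_lt A B hB hlt hm

/-- a gap-one member of every `Y`-degree `d + 2 ≥ 2`: `Y^{d+2} = x·(Y^{d+1} + 1)`, i.e. `A = Y^{d+2}`,
`B = −(Y^{d+1} + 1)` — hypothesis-free thin fibre at every `m₀ ≥ 2`. -/
theorem thinFibreAt_gapOne_example (d : ℕ) {m₀ : ℕ} (hm : 2 ≤ m₀) :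
    ThinFibreAt m₀ (xLinP (X ^ (d + 2)) (-(X ^ (d + 1) + C 1))) := by
  have hB : (-(X ^ (d + 1) + C 1) : ℤ[X]) ≠ 0 := by
    rw [neg_ne_zero]; exact X_pow_add_C_ne_zero (Nat.succ_pos d) 1
  have hdB : (-(X ^ (d + 1) + C 1) : ℤ[X]).natDegree = d + 1 := by
    rw [natDegree_neg, natDegree_X_pow_add_C]
  exact thinFibreAt_xLinear_gapOne _ _ hB (by rw [hdB, natDegree_X_pow]) hm

/-! ### Coefficients of `xLinP`, uniqueness of `(A, B)`, non-members -/

/-- `Y`-coefficients of `xLinP A B`. -/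
theorem coeff_xLinP (A B : ℤ[X]) (i : ℕ) : (xLinP A B).coeff i = C (A.coeff i) + X * C (B.coeff i) := by
  simp [xLinP, Polynomial.coeff_map, coeff_C_mul]

/-- `(A, B)` is determined by the curve: `A_i`, `B_i` are the `x⁰`, `x¹` coefficients of the `Yⁱ` coefficient. -/
theorem xLinP_inj {A B A' B' : ℤ[X]} (h : xLinP A B = xLinP A' B') : A = A' ∧ B = B' := by
  have hc : ∀ i, C (A.coeff i) + X * C (B.coeff i) = C (A'.coeff i) + X * C (B'.coeff i) := fun i => by
    rw [← coeff_xLinP, ← coeff_xLinP, h]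
  constructor
  · ext i
    have := congrArg (fun p : ℤ[X] => p.coeff 0) (hc i)
    simpa only [coeff_add, coeff_C_zero, coeff_X_mul_zero, add_zero] using this
  · ext i
    have := congrArg (fun p : ℤ[X] => p.coeff 1) (hc i)
    simpa only [coeff_add, coeff_C_succ, coeff_X_mul, coeff_C_zero, zero_add] using this

/-- the `Yⁱ`-coefficients of a member have `x`-degree `≤ 1` -/
theorem coeff_coeff_xLinP_eq_zero (A B : ℤ[X]) (i : ℕ) {k : ℕ} (hk : 2 ≤ k) :
    ((xLinP A B).coeff i).coeff k = 0 := by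
  obtain ⟨k, rfl⟩ : ∃ k', k = k' + 2 := ⟨k - 2, by omega⟩
  rw [coeff_xLinP, coeff_add, coeff_C, if_neg (by omega), coeff_X_mul, coeff_C, if_neg (by omega), add_zero]

/-- node-1's failing curve (the line `(x − 1)·Y = 1` through `u⋆`, `not_thinFibre_one`) IS `x`-linear, with
`A = −Y − 1`, `B = Y`: pole gap `0`. -/
theorem lineP_eq_xLinP : lineP = xLinP (-X - 1) X := by
  simp only [lineP, xLinP, Polynomial.map_sub, Polynomial.map_neg, map_X, Polynomial.map_one, map_sub, map_one,
    map_neg]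
  ring

/-- … hence it lies in neither class (its gap is `0`, not `≥ 1`): consistent with `not_thinFibre_one`. -/
theorem not_xLinearLt_lineP : ¬ XLinearLt lineP := by
  rintro ⟨A, B, -, hlt, h⟩
  rw [lineP_eq_xLinP] at h
  obtain ⟨rfl, rfl⟩ := xLinP_inj h
  have h1 : (-X - 1 : ℤ[X]).natDegree = 1 := by
    rw [show (-X - 1 : ℤ[X]) = -(X + C 1) by simp; ring, natDegree_neg, natDegree_X_add_C]
  rw [h1, natDegree_X] at hlt
  exact lt_irrefl _ hlt

/-- Node 1's tightness line `lineP` is NOT in `XLinearGap2`. -/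
theorem not_xLinearGap2_lineP : ¬ XLinearGap2 lineP := fun h => not_xLinearLt_lineP (xLinearLt_of_xLinearGap2 h)

/-- a non-`x`-linear curve, the cusp `Y³ = x²`, is in neither class -/
def cuspP : ℤ[X][X] := X ^ 3 - C (X ^ 2)

/-- The cusp `cuspP` is NOT in `XLinearLt`. -/
theorem not_xLinearLt_cuspP : ¬ XLinearLt cuspP := by
  rintro ⟨A, B, -, -, h⟩
  have h0 := coeff_coeff_xLinP_eq_zero A B 0 (le_refl 2)
  rw [← h, cuspP, coeff_sub, coeff_X_pow, if_neg (by norm_num), coeff_C_zero, zero_sub, coeff_neg, coeff_X_pow,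
    if_pos rfl] at h0
  norm_num at h0

/-- The cusp `cuspP` is NOT in `XLinearGap2`. -/
theorem not_xLinearGap2_cuspP : ¬ XLinearGap2 cuspP := fun h => not_xLinearLt_cuspP (xLinearLt_of_xLinearGap2 h)

/-! ### The consumer: no `x`-linear relation `A(ρ) + ℓ₂·B(ρ) = 0` (`deg B < deg A`) at `ρ ∈ Skel₍m₎`, `m ≥ 2` -/

/-- `dX (xLinP A B) = B` (as a `Y`-polynomial with constant coefficients). -/
theorem dX_xLinP (A B : ℤ[X]) : dX (xLinP A B) = Polynomial.map C B := by
  ext j : 1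
  rw [coeff_dX, coeff_xLinP, Polynomial.coeff_map, derivative_add, derivative_C, derivative_mul, derivative_X,
    derivative_C, zero_add, one_mul, mul_zero, add_zero]

/-- `deg_Y (xLinP A B) ≥ deg A`. -/
theorem natDegree_xLinP_ge (A B : ℤ[X]) : A.natDegree ≤ (xLinP A B).natDegree := by
  by_cases hA : A = 0
  · simp [hA]
  apply le_natDegree_of_ne_zero
  rw [coeff_xLinP]
  intro h
  have := congrArg (fun p : ℤ[X] => p.coeff 0) h
  simp [leadingCoeff_ne_zero.mpr hA] at this

/-- **CONSUMER (the (b)-cell restricted to `x`-linear relations)**: for `ρ ∈ Skel₍m₎`, `m ≥ 2`, and all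
`A, B ∈ ℤ[Y]`, `B ≠ 0`, `deg B < deg A`:  `A(ρ) + ℓ₂·B(ρ) ≠ 0` — i.e. `ℓ₂ ≠ −A(ρ)/B(ρ)`.  (From node 1's
`engine_of_clause` fed with `thinFibreAt_xLinear_of_lt`; the `x`-derivative non-degeneracy is `B(ρ) ≠ 0`, automatic
for the transcendental `ρ`.) -/
theorem xLinear_nonvanishing {m : ℕ} (hm : 2 ≤ m) {ρ : ℝ} (hρ : SkelLiouvilleFix m ρ)
    (A B : ℤ[X]) (hB : B ≠ 0) (hlt : B.natDegree < A.natDegree) :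
    aeval ρ A + liouvilleNumber 2 * aeval ρ B ≠ 0 := by
  intro hzero
  have hroot : bev (xLinP A B) (liouvilleNumber 2) ρ = 0 := by rw [bev_xLinP]; exact hzero
  have hBρ : aeval ρ B ≠ 0 := by
    intro h
    exact hρ.transcendental (by omega) ⟨B, hB, h⟩
  have hτ : bev (dX (xLinP A B)) (liouvilleNumber 2) ρ ≠ 0 := by
    rw [dX_xLinP, bev_map_C]; exact hBρ
  have hd : 1 ≤ (xLinP A B).natDegree := le_trans (by omega) (natDegree_xLinP_ge A B)
  exact engine_of_clause (by omega) hd hroot hτ hρ (thinFibreAt_xLinear_of_lt A B hB hlt hm) |>.elim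

end Summit.Schanuel.Schanuel.Theorems.RootDecomp1KXLinear

end
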